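import Literature.MathematicalPhysics.QuantumFieldTheory.Balaban1983to89.T4AvgDerivBound
import Literature.MathematicalPhysics.QuantumFieldTheory.Balaban1983to89.T4JointDressing
import Literature.MathematicalPhysics.QuantumFieldTheory.Balaban1983to89.T4ReTrLipUnitary

/-!
# T4 (row O3c.E2, addendum β) — the two-variable telescoping: `LoopPairDerivBound` ⇒ `LoopPairOscBound`

Cell `pub-balaban`, sub-cell B07 (unit `b2b-balaban-b07-g5`, gen 5), row **T4-O3c.E2** of `t4/T4-DAG.md` v3, item (β) of
`t4/T4-EST-O3cE2.md` §5 («a bridge lemma `LoopPairDerivBound ∧ (bdist ≤ D on dom) ∧ FibreConvex ⇒ LoopPairOscBound av dom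
(C₂D²) θ₂` is routine two-variable telescoping»).  This leaf module writes that telescoping out in the kernel.  It is the
typed EDGE from the size-weighted mixed second-difference shape of `T4AvgDerivBound` (one bond × one bond, product of the
two sizes) to the pair-sensitivity shape `T4JointDressing.LoopPairOscBound` of node O3b (ii) (finite set × finite set,
`|Λ|·|Λ′|`), on FIBRE-CONVEX domains (`T4AvgDerivBound.FibreConvex`: bondwise-between configurations stay in the domain)
whose one-bond changes have size at most `D`.

WHAT IS PROVED ([folklore]; pure bookkeeping over the two hypothesis SHAPES — no instance of either shape is claimed and
nothing printed by Bałaban is asserted):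
* `LoopPairDerivBound.sum_right` — bond × finite set: change the bonds of `Λ′` one at a time in the second variable;
* `LoopPairDerivBound.sum_sum` — finite set × finite set (disjoint): change the bonds of `Λ` one at a time in the first
  variable, each step being a bond × set rectangle; the bound is `C₂·|w|·(Σ_{a∈Λ} size_a)·(Σ_{c∈Λ′} size_c)·θ₂ⁿ`;
* `loopPairOscBound_of_loopPairDerivBound` — with sizes `≤ D` on the domain: `LoopPairOscBound av dom (C₂·D²) θ₂`.

v1.1 (append-only §2, NON-VACUITY of the two side hypotheses): `fibreConvex_univ`, `fibreConvex_bondwise` (every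
BONDWISE product domain `{V | ∀ b, V b ∈ S j b}` — e.g. an axial-gauge small-field box — is fibre-convex),
`loopPairOscBound_of_loopPairDerivBound_of_dist1_le` (a global bound `dist1 ≤ B` on `G` supplies the size bound with
`D = B` on ANY domain), `dist1_le_two_ofUnitaryRep` (`dist1 ≤ 2` in the unitary model of `UnitaryModel` /
`T4ReTrLipUnitary`, imported for this purpose) and the fully discharged corollary over `SU(n)`:
`loopPairOscBound_of_loopPairDerivBound_specialUnitary : LoopPairDerivBound av dom C₂ θ₂ → FibreConvex dom → 0 ≤ C₂ →
0 ≤ θ₂ → LoopPairOscBound av dom (4·C₂) θ₂`.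

CAVEAT (t4/T4-EST-O3cE2.md §4 (F6)): fibre-convexity is TRUE for product domains in the bond variables (axial-gauge
small-field boxes) and FALSE in general for plaquette-defined domains; the hypothesis is explicit here, exactly as in
`T4AvgDerivBound.loopOscBound_of_loopDerivBound`.

References (context only): [Balaban1985Averaging] (11) p.19 (covariance of the averaging, the printed input of the whole
O3c chain via `Setup.Averaging.covariant`).  value = typed edge between two hypothesis shapes, NOT summit progress.
-/

open scoped BigOperators

namespace Literature.MathematicalPhysics.QuantumFieldTheory.Balaban1983to89.T4PairDerivBridge

open Literature.MathematicalPhysics.QuantumFieldTheory.Balaban1983to89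
open Literature.MathematicalPhysics.QuantumFieldTheory.Balaban1983to89.T4Continuum
open Literature.MathematicalPhysics.QuantumFieldTheory.Balaban1983to89.T4AvgSensitivity
open Literature.MathematicalPhysics.QuantumFieldTheory.Balaban1983to89.T4AvgDerivBound
open Literature.MathematicalPhysics.QuantumFieldTheory.Balaban1983to89.T4JointDressing

variable {P : Params} {G : Type*} [GaugeGroup G]

/-! ## §1 The two-variable telescoping and the bridge -/

/-- BOND × FINITE SET.  On a fibre-convex domain, the one-bond × one-bond mixed second-difference shape bounds the mixed
second difference for a change at one bond `b` (first variable) against a change on a finite set `Λ′ ∌ b` (second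
variable) by `C₂ · |w| · size_b · (Σ_{c∈Λ′} size_c) · θ₂ⁿ` — change the bonds of `Λ′` one at a time; every intermediate
corner is bondwise between two domain corners, hence in the domain. [folklore] -/
theorem LoopPairDerivBound.sum_right {av : ∀ j, Averaging P j G} {dom : ∀ j, Set (GaugeField P j G)} {C₂ θ₂ : ℝ}
    (h : LoopPairDerivBound av dom C₂ θ₂) (hconv : FibreConvex dom) {k : ℕ} (n : ℕ) (hn : k + n ≤ P.m + P.K)
    (x : Site P (k + n)) (w : List (Letter P.d)) (hw : walkEnd x w = x) (b : PBond P k) :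
    ∀ (Λ' : Finset (PBond P k)), b ∉ Λ' → ∀ (V V₁ V₂ V₁₂ : GaugeField P k G),
      V ∈ dom k → V₁ ∈ dom k → V₂ ∈ dom k → V₁₂ ∈ dom k →
      (∀ c, c ≠ b → V₁ c = V c) → (∀ c, c ∉ Λ' → V₂ c = V c) → (∀ c, c ≠ b → V₁₂ c = V₂ c) → V₁₂ b = V₁ b →
        |loopAt (iterFrom av k n V₁₂) (walk x w) - loopAt (iterFrom av k n V₁) (walk x w)
            - loopAt (iterFrom av k n V₂) (walk x w) + loopAt (iterFrom av k n V) (walk x w)|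
          ≤ C₂ * (w.length : ℝ) * bdist (V b) (V₁ b) * (∑ c ∈ Λ', bdist (V c) (V₂ c)) * θ₂ ^ n := by
  classical
  intro Λ'
  induction Λ' using Finset.induction_on with
  | empty =>
    intro _ V V₁ V₂ V₁₂ _ _ _ _ h1 h2 h12 h12b
    have e₂ : V₂ = V := funext fun c => h2 c (by simp)
    have e₁₂ : V₁₂ = V₁ := funext fun c => by
      by_cases hc : c = b
      · subst hc; exact h12b
      · rw [h12 c hc, h1 c hc]; exact congrFun e₂ c
    subst e₂; subst e₁₂
    simp
  | @insert c Λ' hc ih =>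
    intro hb V V₁ V₂ V₁₂ hV hV₁ hV₂ hV₁₂ h1 h2 h12 h12b
    have hcb : c ≠ b := fun hcb => hb (by simp [hcb])
    have hbΛ : b ∉ Λ' := fun hbΛ => hb (Finset.mem_insert_of_mem hbΛ)
    -- the two intermediate corners: the bond `c` of the second variable already changed
    set W₂ : GaugeField P k G := Function.update V c (V₂ c) with hW₂def
    set W₁₂ : GaugeField P k G := Function.update V₁ c (V₂ c) with hW₁₂def
    have hW₂mem : W₂ ∈ dom k := hconv k V V₂ W₂ hV hV₂ fun y => by
      by_cases hy : y = c
      · subst hy; right; simp [hW₂def]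
      · left; simp [hW₂def, Function.update_of_ne hy]
    have hW₁₂mem : W₁₂ ∈ dom k := hconv k V₁ V₁₂ W₁₂ hV₁ hV₁₂ fun y => by
      by_cases hy : y = c
      · subst hy; right; simp [hW₁₂def, h12 _ hcb]
      · left; simp [hW₁₂def, Function.update_of_ne hy]
    -- values of the intermediate corners
    have hW₂c : W₂ c = V₂ c := by simp [hW₂def]
    have hW₂_of_ne : ∀ y, y ≠ c → W₂ y = V y := fun y hy => by simp [hW₂def, Function.update_of_ne hy]
    have hW₁₂c : W₁₂ c = V₂ c := by simp [hW₁₂def]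
    have hW₁₂_of_ne : ∀ y, y ≠ c → W₁₂ y = V₁ y := fun y hy => by simp [hW₁₂def, Function.update_of_ne hy]
    have hW₁₂W₂ : ∀ y, y ≠ b → W₁₂ y = W₂ y := fun y hy => by
      by_cases hyc : y = c
      · rw [hyc, hW₁₂c, hW₂c]
      · rw [hW₁₂_of_ne y hyc, hW₂_of_ne y hyc, h1 y hy]
    have hW₂b : W₂ b = V b := hW₂_of_ne b (Ne.symm hcb)
    have hW₁₂b : W₁₂ b = V₁ b := hW₁₂_of_ne b (Ne.symm hcb)
    -- first square: bonds `b` × `c`, corners `V, V₁, W₂, W₁₂`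
    have B1 := h k n hn x w hw b c (Ne.symm hcb) V V₁ W₂ W₁₂ hV hV₁ hW₂mem hW₁₂mem h1 hW₂_of_ne hW₁₂W₂ hW₁₂b
    rw [hW₂c] at B1
    -- second rectangle: bond `b` × the set `Λ'`, corners `W₂, W₁₂, V₂, V₁₂`
    have B2 := ih hbΛ W₂ W₁₂ V₂ V₁₂ hW₂mem hW₁₂mem hV₂ hV₁₂ hW₁₂W₂
      (fun y hy => by
        by_cases hyc : y = c
        · rw [hyc, hW₂c]
        · rw [hW₂_of_ne y hyc, h2 y (by simp [hyc, hy])])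
      h12 (by rw [h12b, hW₁₂b])
    rw [hW₂b, hW₁₂b] at B2
    have hsum : ∑ y ∈ Λ', bdist (W₂ y) (V₂ y) = ∑ y ∈ Λ', bdist (V y) (V₂ y) := by
      refine Finset.sum_congr rfl fun y hy => ?_
      have hyc : y ≠ c := fun hyc => hc (hyc ▸ hy)
      rw [hW₂_of_ne y hyc]
    rw [hsum] at B2
    rw [Finset.sum_insert hc]
    have hsplit : loopAt (iterFrom av k n V₁₂) (walk x w) - loopAt (iterFrom av k n V₁) (walk x w)
          - loopAt (iterFrom av k n V₂) (walk x w) + loopAt (iterFrom av k n V) (walk x w)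
        = (loopAt (iterFrom av k n W₁₂) (walk x w) - loopAt (iterFrom av k n V₁) (walk x w)
            - loopAt (iterFrom av k n W₂) (walk x w) + loopAt (iterFrom av k n V) (walk x w))
          + (loopAt (iterFrom av k n V₁₂) (walk x w) - loopAt (iterFrom av k n W₁₂) (walk x w)
            - loopAt (iterFrom av k n V₂) (walk x w) + loopAt (iterFrom av k n W₂) (walk x w)) := by ring
    rw [hsplit]
    refine (abs_add_le _ _).trans ?_
    refine (add_le_add B1 B2).trans ?_
    apply le_of_eq
    ring

/-- FINITE SET × FINITE SET.  On a fibre-convex domain, the one-bond × one-bond mixed second-difference shape bounds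
the mixed second difference over a rectangle of configurations (`V`; `V₁` = `V` changed on `Λ`; `V₂` = `V` changed on
`Λ′`; `V₁₂` = both changes; `Λ`, `Λ′` disjoint) by `C₂ · |w| · (Σ_{a∈Λ} size_a) · (Σ_{c∈Λ′} size_c) · θ₂ⁿ` — change
the bonds of `Λ` one at a time, each step a bond × set rectangle (`sum_right`). [folklore] -/
theorem LoopPairDerivBound.sum_sum {av : ∀ j, Averaging P j G} {dom : ∀ j, Set (GaugeField P j G)} {C₂ θ₂ : ℝ}
    (h : LoopPairDerivBound av dom C₂ θ₂) (hconv : FibreConvex dom) {k : ℕ} (n : ℕ) (hn : k + n ≤ P.m + P.K)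
    (x : Site P (k + n)) (w : List (Letter P.d)) (hw : walkEnd x w = x) :
    ∀ (Λ Λ' : Finset (PBond P k)), Disjoint Λ Λ' → ∀ (V V₁ V₂ V₁₂ : GaugeField P k G),
      V ∈ dom k → V₁ ∈ dom k → V₂ ∈ dom k → V₁₂ ∈ dom k →
      (∀ c, c ∉ Λ → V₁ c = V c) → (∀ c, c ∉ Λ' → V₂ c = V c) →
      (∀ c, c ∉ Λ' → V₁₂ c = V₁ c) → (∀ c, c ∉ Λ → V₁₂ c = V₂ c) →
        |loopAt (iterFrom av k n V₁₂) (walk x w) - loopAt (iterFrom av k n V₁) (walk x w)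
            - loopAt (iterFrom av k n V₂) (walk x w) + loopAt (iterFrom av k n V) (walk x w)|
          ≤ C₂ * (w.length : ℝ) * (∑ a ∈ Λ, bdist (V a) (V₁ a)) * (∑ c ∈ Λ', bdist (V c) (V₂ c)) * θ₂ ^ n := by
  classical
  intro Λ
  induction Λ using Finset.induction_on with
  | empty =>
    intro Λ' _ V V₁ V₂ V₁₂ _ _ _ _ h1 _ _ h122
    have e₁ : V₁ = V := funext fun c => h1 c (by simp)
    have e₁₂ : V₁₂ = V₂ := funext fun c => h122 c (by simp)
    subst e₁; subst e₁₂
    simp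
  | @insert a Λ ha ih =>
    intro Λ' hdisj V V₁ V₂ V₁₂ hV hV₁ hV₂ hV₁₂ h1 h2 h121 h122
    have haΛ' : a ∉ Λ' := Finset.disjoint_left.mp hdisj (Finset.mem_insert_self a Λ)
    have hdisj' : Disjoint Λ Λ' := Finset.disjoint_of_subset_left (Finset.subset_insert a Λ) hdisj
    -- the two intermediate corners: the bond `a` of the first variable already changed
    set W₁ : GaugeField P k G := Function.update V a (V₁ a) with hW₁def
    set W₁₂ : GaugeField P k G := Function.update V₂ a (V₁ a) with hW₁₂def
    have hV₁₂a : V₁₂ a = V₁ a := h121 a haΛ'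
    have hW₁mem : W₁ ∈ dom k := hconv k V V₁ W₁ hV hV₁ fun y => by
      by_cases hy : y = a
      · subst hy; right; simp [hW₁def]
      · left; simp [hW₁def, Function.update_of_ne hy]
    have hW₁₂mem : W₁₂ ∈ dom k := hconv k V₂ V₁₂ W₁₂ hV₂ hV₁₂ fun y => by
      by_cases hy : y = a
      · subst hy; right; simp [hW₁₂def, hV₁₂a]
      · left; simp [hW₁₂def, Function.update_of_ne hy]
    have hW₁a : W₁ a = V₁ a := by simp [hW₁def]
    have hW₁_of_ne : ∀ y, y ≠ a → W₁ y = V y := fun y hy => by simp [hW₁def, Function.update_of_ne hy]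
    have hW₁₂a : W₁₂ a = V₁ a := by simp [hW₁₂def]
    have hW₁₂_of_ne : ∀ y, y ≠ a → W₁₂ y = V₂ y := fun y hy => by simp [hW₁₂def, Function.update_of_ne hy]
    -- first rectangle: bond `a` × the set `Λ'`, corners `V, W₁, V₂, W₁₂`
    have B1 := LoopPairDerivBound.sum_right h hconv n hn x w hw a Λ' haΛ' V W₁ V₂ W₁₂ hV hW₁mem hV₂ hW₁₂mem hW₁_of_ne h2 hW₁₂_of_ne
      (by rw [hW₁₂a, hW₁a])
    rw [hW₁a] at B1
    -- second rectangle: the set `Λ` × the set `Λ'`, corners `W₁, V₁, W₁₂, V₁₂`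
    have B2 := ih Λ' hdisj' W₁ V₁ W₁₂ V₁₂ hW₁mem hV₁ hW₁₂mem hV₁₂
      (fun y hy => by
        by_cases hya : y = a
        · rw [hya, hW₁a]
        · rw [hW₁_of_ne y hya, h1 y (by simp [hya, hy])])
      (fun y hy => by
        by_cases hya : y = a
        · rw [hya, hW₁₂a, hW₁a]
        · rw [hW₁₂_of_ne y hya, hW₁_of_ne y hya, h2 y hy])
      h121
      (fun y hy => by
        by_cases hya : y = a
        · rw [hya, hV₁₂a, hW₁₂a]
        · rw [hW₁₂_of_ne y hya, h122 y (by simp [hya, hy])])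
    have hsum1 : ∑ y ∈ Λ, bdist (W₁ y) (V₁ y) = ∑ y ∈ Λ, bdist (V y) (V₁ y) := by
      refine Finset.sum_congr rfl fun y hy => ?_
      have hya : y ≠ a := fun hya => ha (hya ▸ hy)
      rw [hW₁_of_ne y hya]
    have hsum2 : ∑ y ∈ Λ', bdist (W₁ y) (W₁₂ y) = ∑ y ∈ Λ', bdist (V y) (V₂ y) := by
      refine Finset.sum_congr rfl fun y hy => ?_
      have hya : y ≠ a := fun hya => haΛ' (hya ▸ hy)
      rw [hW₁_of_ne y hya, hW₁₂_of_ne y hya]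
    rw [hsum1, hsum2] at B2
    rw [Finset.sum_insert ha]
    have hsplit : loopAt (iterFrom av k n V₁₂) (walk x w) - loopAt (iterFrom av k n V₁) (walk x w)
          - loopAt (iterFrom av k n V₂) (walk x w) + loopAt (iterFrom av k n V) (walk x w)
        = (loopAt (iterFrom av k n W₁₂) (walk x w) - loopAt (iterFrom av k n W₁) (walk x w)
            - loopAt (iterFrom av k n V₂) (walk x w) + loopAt (iterFrom av k n V) (walk x w))
          + (loopAt (iterFrom av k n V₁₂) (walk x w) - loopAt (iterFrom av k n V₁) (walk x w)
            - loopAt (iterFrom av k n W₁₂) (walk x w) + loopAt (iterFrom av k n W₁) (walk x w)) := by ring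
    rw [hsplit]
    refine (abs_add_le _ _).trans ?_
    refine (add_le_add B1 B2).trans ?_
    apply le_of_eq
    ring

/-- **THE BRIDGE (β)**: on a fibre-convex domain whose one-bond changes have size at most `D`, the size-weighted mixed
second-difference shape `LoopPairDerivBound av dom C₂ θ₂` implies the pair-sensitivity shape of node O3b (ii),
`T4JointDressing.LoopPairOscBound av dom (C₂ · D²) θ₂` — the `|Λ|·|Λ′|`-bilinear constant `C₂D²` and the SAME rate
`θ₂`. [folklore] -/
theorem loopPairOscBound_of_loopPairDerivBound {av : ∀ j, Averaging P j G} {dom : ∀ j, Set (GaugeField P j G)}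
    {C₂ θ₂ D : ℝ} (h : LoopPairDerivBound av dom C₂ θ₂) (hconv : FibreConvex dom) (hC : 0 ≤ C₂) (hθ : 0 ≤ θ₂)
    (hD : ∀ k (V V' : GaugeField P k G), V ∈ dom k → V' ∈ dom k → ∀ b, bdist (V b) (V' b) ≤ D) :
    LoopPairOscBound av dom (C₂ * D ^ 2) θ₂ := by
  intro k n hn x w hw Λ Λ' hdisj V V₁ V₂ V₁₂ hV hV₁ hV₂ hV₁₂ h1 h2 h121 h122
  have hB := LoopPairDerivBound.sum_sum h hconv n hn x w hw Λ Λ' hdisj V V₁ V₂ V₁₂ hV hV₁ hV₂ hV₁₂ h1 h2 h121 h122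
  have hS1 : ∑ a ∈ Λ, bdist (V a) (V₁ a) ≤ (Λ.card : ℝ) * D := by
    have := Finset.sum_le_card_nsmul Λ (fun a => bdist (V a) (V₁ a)) D fun a _ => hD k V V₁ hV hV₁ a
    simpa [nsmul_eq_mul] using this
  have hS2 : ∑ c ∈ Λ', bdist (V c) (V₂ c) ≤ (Λ'.card : ℝ) * D := by
    have := Finset.sum_le_card_nsmul Λ' (fun c => bdist (V c) (V₂ c)) D fun c _ => hD k V V₂ hV hV₂ c
    simpa [nsmul_eq_mul] using this
  have hS1nn : 0 ≤ ∑ a ∈ Λ, bdist (V a) (V₁ a) := Finset.sum_nonneg fun a _ => bdist_nonneg _ _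
  have hS2nn : 0 ≤ ∑ c ∈ Λ', bdist (V c) (V₂ c) := Finset.sum_nonneg fun c _ => bdist_nonneg _ _
  have hprod : (∑ a ∈ Λ, bdist (V a) (V₁ a)) * (∑ c ∈ Λ', bdist (V c) (V₂ c))
      ≤ ((Λ.card : ℝ) * D) * ((Λ'.card : ℝ) * D) :=
    mul_le_mul hS1 hS2 hS2nn (hS1nn.trans hS1)
  have hpre : 0 ≤ C₂ * (w.length : ℝ) * θ₂ ^ n := by positivity
  calc |loopAt (iterFrom av k n V₁₂) (walk x w) - loopAt (iterFrom av k n V₁) (walk x w)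
          - loopAt (iterFrom av k n V₂) (walk x w) + loopAt (iterFrom av k n V) (walk x w)|
      ≤ C₂ * (w.length : ℝ) * (∑ a ∈ Λ, bdist (V a) (V₁ a)) * (∑ c ∈ Λ', bdist (V c) (V₂ c)) * θ₂ ^ n := hB
    _ = (C₂ * (w.length : ℝ) * θ₂ ^ n) * ((∑ a ∈ Λ, bdist (V a) (V₁ a)) * (∑ c ∈ Λ', bdist (V c) (V₂ c))) := by
        ring
    _ ≤ (C₂ * (w.length : ℝ) * θ₂ ^ n) * (((Λ.card : ℝ) * D) * ((Λ'.card : ℝ) * D)) :=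
        mul_le_mul_of_nonneg_left hprod hpre
    _ = C₂ * D ^ 2 * (w.length : ℝ) * (Λ.card : ℝ) * (Λ'.card : ℝ) * θ₂ ^ n := by ring

/-! ## §2 (v1.1) Non-vacuity of the side hypotheses: fibre-convex domains and the size bound -/

omit [GaugeGroup G] in
/-- The unrestricted domain is fibre-convex. [folklore] -/
theorem fibreConvex_univ : FibreConvex (P := P) (fun j => (Set.univ : Set (GaugeField P j G))) :=
  fun _ _ _ _ _ _ _ => Set.mem_univ _

omit [GaugeGroup G] in
/-- Every BONDWISE product domain `{V | ∀ b, V b ∈ S j b}` (e.g. an axial-gauge small-field box `dist1 (V b) < ε` for all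
`b`) is fibre-convex: a configuration taking at each bond the value of one of two members is a member. [folklore] -/
theorem fibreConvex_bondwise (S : ∀ j, PBond P j → Set G) :
    FibreConvex (P := P) (fun j => {V : GaugeField P j G | ∀ b, V b ∈ S j b}) := by
  intro j V V' W hV hV' hW b
  rcases hW b with hb | hb
  · rw [hb]; exact hV b
  · rw [hb]; exact hV' b

/-- A global bound `dist1 ≤ B` on the group supplies the size hypothesis of the bridge with `D = B` on any domain:
`LoopPairDerivBound av dom C₂ θ₂ ⇒ LoopPairOscBound av dom (C₂·B²) θ₂` on fibre-convex domains. [folklore] -/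
theorem loopPairOscBound_of_loopPairDerivBound_of_dist1_le {av : ∀ j, Averaging P j G}
    {dom : ∀ j, Set (GaugeField P j G)} {C₂ θ₂ B : ℝ} (hB : ∀ g : G, dist1 g ≤ B)
    (h : LoopPairDerivBound av dom C₂ θ₂) (hconv : FibreConvex dom) (hC : 0 ≤ C₂) (hθ : 0 ≤ θ₂) :
    LoopPairOscBound av dom (C₂ * B ^ 2) θ₂ :=
  loopPairOscBound_of_loopPairDerivBound h hconv hC hθ fun _ V V' _ _ b => by
    rw [bdist_def]; exact hB _

section Unitary

open scoped Matrix.Norms.L2Operator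
open Literature.MathematicalPhysics.QuantumFieldTheory.Balaban1983to89.UnitaryModel

variable {n : Type*} [Fintype n] [DecidableEq n] [Nonempty n]

/-- In the unitary model (`GaugeGroup.ofUnitaryRep`: `dist1 h = ‖ρ h − 1‖_{op}`) the invariant metric is bounded by `2`
(`‖ρ h‖ = ‖1‖ = 1`). [folklore] -/
theorem dist1_le_two_ofUnitaryRep {H : Type*} [Group H] (ρ : H →* Matrix n n ℂ)
    (hρ : ∀ h, ρ h ∈ Matrix.unitaryGroup n ℂ) (h : H) : (GaugeGroup.ofUnitaryRep H ρ hρ).dist1 h ≤ 2 := by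
  show opDist1 (ρ h) ≤ 2
  unfold opDist1
  calc ‖ρ h - 1‖ ≤ ‖ρ h‖ + ‖(1 : Matrix n n ℂ)‖ := norm_sub_le _ _
    _ = 2 := by
        rw [norm_of_mem_unitaryGroup (hρ h), norm_of_mem_unitaryGroup (Submonoid.one_mem _)]
        norm_num

open Literature.MathematicalPhysics.QuantumLattice in
/-- `dist1 U ≤ 2` on `SU(n)` (the tree instance `instGaugeGroupSpecialUnitaryGroup`). [folklore] -/
theorem dist1_le_two_specialUnitaryGroup (U : Matrix.specialUnitaryGroup n ℂ) : dist1 U ≤ 2 :=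
  dist1_le_two_ofUnitaryRep (fundamentalRep n) fundamentalRep_mem_unitaryGroup U

/-- FULLY DISCHARGED COROLLARY over `SU(n)`: on a fibre-convex domain, `LoopPairDerivBound av dom C₂ θ₂` implies
`LoopPairOscBound av dom (4·C₂) θ₂` (sizes `≤ 2` automatically). [folklore] -/
theorem loopPairOscBound_of_loopPairDerivBound_specialUnitary
    {av : ∀ j, Averaging P j (Matrix.specialUnitaryGroup n ℂ)}
    {dom : ∀ j, Set (GaugeField P j (Matrix.specialUnitaryGroup n ℂ))} {C₂ θ₂ : ℝ}
    (h : LoopPairDerivBound av dom C₂ θ₂) (hconv : FibreConvex dom) (hC : 0 ≤ C₂) (hθ : 0 ≤ θ₂) :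
    LoopPairOscBound av dom (4 * C₂) θ₂ := by
  have h4 : C₂ * (2 : ℝ) ^ 2 = 4 * C₂ := by ring
  rw [← h4]
  exact loopPairOscBound_of_loopPairDerivBound_of_dist1_le dist1_le_two_specialUnitaryGroup h hconv hC hθ

end Unitary

end Literature.MathematicalPhysics.QuantumFieldTheory.Balaban1983to89.T4PairDerivBridge
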